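import Summits.CriticalPhenomena.PercolationContinuityZ3.Theorems.PercNearOneGluingNoHeavyQuantDECAtTMixtures
import Summits.CriticalPhenomena.PercolationContinuityZ3.Theorems.PercNearOneGluingNoHeavyQuantBlobDecTwoLaw
import Summits.CriticalPhenomena.PercolationContinuityZ3.Theorems.PercNearOneGluingNoHeavyQuantLawDecAbsorbPairs
import HarnessLib

/-!
# QUANT lane R8, T-DEC: the light two-blob law at its credit target, part 1 — TOOLS: the affordable region (Theorem A), the two-atom pieces,
# the per-absorber capacity bound `cap_ge` and THE CAPACITY INEQUALITY `lightTwoBlob_capacity` (sub-case O's certificate, exact)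

builds on p205010 (kernel theorem, internal audit signed; external expert review pending)

Support file (`--supports stmt-CriticalPhenomena-4575`), QUANT lane typer seat prim-quant-stmt (gen 22), rung R8 of `run/shared/lean/prim/quant/LADDER.md`.
Theorems only, standard axioms, no sorries; depends only on long-landed modules (the statements are the body of `LawDec.LightTwoBlobDEC` under an
extra hypothesis, without referring to that definition).  LAW: `LAW2[b, γ; a, g]` = law of `b·Bern(γ) + a·Bern(g)` (atoms `0, b, a, b+a`, masses
`(1−γ)(1−g), γ(1−g), (1−γ)g, γg`), LIGHT `x² < γ < x`, heavy `x ≤ g ≤ 1`, target `c = bκ + ag`, `κ = (γ−x²)/(1−x)`, layer `j″ ≥ a+b` (no giants);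
mean `bγ + ag = c + b(γ−κ)`, `γ − κ = x(x−κ)`, `x − κ = (x−γ)/(1−x)`.
* `lightTwoBlob_decAtT_of_affordable` — `x(a+b) ≤ bγ + ag` ⟹ DEC(j″) at `c` (Theorem A at the mean + `decAtT_antitone_target`).
* (part 2, `…QuantLightTwoBlobCaseO`) **`lightTwoBlob_decAtT_caseO`** — `c ≤ 2a`, `c ≤ 2b` (only atom `0` low) ⟹ DEC(j″) at `c`, ALL parameters.  Atom `0` is shipped to each compatible
  absorber `h ∈ {b, a, b+a}` (`c < h`) proportionally to its capacity `CAP = m_h(1−γ_h)/γ_h`, `γ_h = max(c/h, x²+(1−x)c/h)` (`decAtT_zeroShare`,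
  `decAtT_zeroAbsorber`, `LawDec.validAt_creditPair`); feasible iff **`lightTwoBlob_capacity`: `m₀ ≤ Σ CAP`**, proved exactly via `cap_ge`: a light
  absorber (`c < hx`) has `(1−γ_h)/γ_h = h/c − 1 − x(hx−c)/(cγ_h)` and `γ_h ≥ γ` (as `c ≥ hκ` for `h ∈ {b, b+a}`; `h = a` is never light, `c ≥ ag ≥ ax`),
  a heavy compatible one `CAP = m_h(h/c − 1)`, an incompatible one `0 ≥ m_h(h/c − 1)`; summing, `Σ CAP − m₀ ≥ (mean − c)/c − (x/(cγ))Σ_light m_h(hx−c)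
  ≥ (x/c)[b(x−κ) − (γ(1−g) + γg)·b(x−κ)/γ] = 0` (`hx − c ≤ b(x−κ)` for `h ∈ {b, b+a}`).  Assembly by `decAtT_finite_mixture` over `Fin 3`.
WHAT REMAINS of `LightTwoBlobDEC`: sub-cases "a low" / "b low" OUTSIDE the affordable region (≈ 6 % of the census; the low one is the smaller of
`a, b`, both pairs into `b+a` light); certificate = "low atom to `b+a` first, then the other mid; atom 0 takes the residual capacities"
(FOR-PROVERS-SL §4) — a proportional split is NOT enough there (234 / 3 082 exact failures).

[this work]; DEC rules ARCH-TREES-G49 §2.2 / DEC-TAMP-G50 §3.1 (this lane).  The gluing rows served [cite: KozmaNitzan2024, Conjecture 3 (p. 15)];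
product measure [cite: Grimmett1999, §1.3 p. 10].
-/

noncomputable section

namespace Summit.CriticalPhenomena.PercolationContinuityZ3.Theorems

namespace Quant

open Finset

/-- the two-blob law `(1−u)(1−v)δ₀ + u(1−v)δ_a + (1−u)vδ_b + uvδ_{a+b}` evaluated at `h` (as in `…QuantBlobDecTwoLawParts`) -/
local notation3 "LAW2[" a ", " u ", " b ", " v ", " h "]" =>
  (1 - (u : ℝ)) * (1 - (v : ℝ)) * (if (h : ℕ) = 0 then (1 : ℝ) else 0)
    + (u : ℝ) * (1 - (v : ℝ)) * (if (h : ℕ) = (a : ℕ) then (1 : ℝ) else 0)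
    + (1 - (u : ℝ)) * (v : ℝ) * (if (h : ℕ) = (b : ℕ) then (1 : ℝ) else 0)
    + (u : ℝ) * (v : ℝ) * (if (h : ℕ) = (a : ℕ) + (b : ℕ) then (1 : ℝ) else 0)

namespace LawDec

/-! ### The Theorem-A region -/

/-- **the affordable region**: if `x·(a+b) ≤ bγ + ag` (`0 < x < 1`, gates in `[0,1]`) then `LAW2[b,γ;a,g]` is DEC(j″) at every target
`c ≤ bγ + ag` for every layer `j″ ≥ b + a` (Theorem A at the mean, then antitone). [this work] -/
theorem lightTwoBlob_decAtT_of_affordable (x γ g c : ℝ) (a b j'' : ℕ) (hx0 : 0 < x) (hx1 : x < 1) (hγ0 : 0 ≤ γ) (hγ1 : γ ≤ 1)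
    (hg0 : 0 ≤ g) (hg1 : g ≤ 1) (hj : b + a ≤ j'') (hA : x * ((b : ℝ) + a) ≤ (b : ℝ) * γ + (a : ℝ) * g)
    (hc : c ≤ (b : ℝ) * γ + (a : ℝ) * g) :
    DECAtT x c j'' (b + a) (fun h => LAW2[b, γ, a, g, h]) := by
  have hmean : ∑ h ∈ Finset.range (b + a + 1), (h : ℝ) * (fun h => LAW2[b, γ, a, g, h]) h = b * γ + a * g :=
    BlobDec2.law_mean b a γ g
  have hdec : DECAt x j'' (b + a) (fun h => LAW2[b, γ, a, g, h]) := by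
    refine decAt_of_top_le (b + a) _ (fun h => BlobDec2.law_nonneg b a γ g hγ0 hγ1 hg0 hg1 h)
      (fun h hh => BlobDec2.law_eq_zero_of_lt b a γ g h hh) (BlobDec2.law_mass b a γ g) x hx1 ?_ j'' hj
    intro h hh
    rw [hmean]
    exact (BlobDec2.law_pos_atom_le b a γ g x hx0.le h hh).trans hA
  rw [decAt_iff_decAtT, hmean] at hdec
  exact decAtT_antitone_target hc hdec

/-! ### Sub-case O: only atom 0 is low -/

/-- capacity (in low-mass units) of an absorber of mass `m` at height `H` for the low atom `0`, target `c`, floor `x`: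
`[c < H]·m(1−γ_H)/γ_H`, `γ_H = max(c/H, x² + (1−x)c/H)` -/
local notation3 "CAP[" x ", " c ", " H ", " m "]" =>
  (if (c : ℝ) < (H : ℝ) then (m : ℝ) * (1 - max ((c : ℝ) / (H : ℝ)) ((x : ℝ) ^ 2 + (1 - (x : ℝ)) * ((c : ℝ) / (H : ℝ))))
    / max ((c : ℝ) / (H : ℝ)) ((x : ℝ) ^ 2 + (1 - (x : ℝ)) * ((c : ℝ) / (H : ℝ))) else (0 : ℝ))

/-- **two atoms: a share `p` of the low atom `0` against one self-sufficient absorber `h`.**  The law `p·δ₀ + (1−p)·δ_h` (`0 ≤ p ≤ 1`,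
`h ≤ j″`, `h ≤ M`, `c ≤ 2h`, `0 < c`, `0 < x < 1`) is DEC(j″) at target `c` as soon as `p = 0`, or `c < h` and the pair `{0, h}` at its minimal
credit gate `γ_h = max(c/h, x² + (1−x)c/h)` can carry `p` against `1 − p`: `p·γ_h ≤ (1−p)(1−γ_h)`. [this work] -/
theorem decAtT_zeroAbsorber (x c p : ℝ) (j'' M h : ℕ) (hx0 : 0 < x) (hx1 : x < 1) (hp0 : 0 ≤ p) (hp1 : p ≤ 1) (hhM : h ≤ M)
    (hhj : h ≤ j'') (h2h : c ≤ 2 * (h : ℝ)) (hc0 : 0 < c)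
    (hcap : p = 0 ∨ (c < (h : ℝ) ∧ p * max (c / h) (x ^ 2 + (1 - x) * (c / h)) ≤ (1 - p) * (1 - max (c / h) (x ^ 2 + (1 - x) * (c / h))))) :
    DECAtT x c j'' M (fun t => p * (if t = 0 then (1 : ℝ) else 0) + (1 - p) * (if t = h then (1 : ℝ) else 0)) := by
  classical
  rcases hcap with hp | ⟨hch, hcap⟩
  · -- the point mass at h
    subst hp
    refine ⟨Unit, inferInstance, fun _ => 1, fun _ => 1, fun _ => h, fun _ => h, fun _ => zero_le_one, by simp,
      fun _ => ⟨zero_le_one, le_rfl⟩, fun _ => le_rfl, fun _ => hhM, fun t => by simp, fun _ _ => Or.inl ⟨rfl, Or.inl h2h⟩⟩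
  · obtain ⟨γh, hγh⟩ : ∃ γh : ℝ, γh = max (c / h) (x ^ 2 + (1 - x) * (c / h)) := ⟨_, rfl⟩
    rw [← hγh] at hcap
    have hhpos : (0 : ℝ) < h := lt_trans hc0 hch
    have hh0 : 0 < h := by exact_mod_cast hhpos
    have hρ1 : c / (h : ℝ) < 1 := by rw [div_lt_one hhpos]; exact hch
    have hρ0 : 0 < c / (h : ℝ) := div_pos hc0 hhpos
    have hγ0 : 0 < γh := by rw [hγh]; exact lt_of_lt_of_le hρ0 (le_max_left _ _)
    have hγ1 : γh < 1 := by
      rw [hγh]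
      refine max_lt hρ1 ?_
      have h1x : 0 < 1 - x := by linarith
      nlinarith [mul_lt_mul_of_pos_left hρ1 h1x]
    have h1γ : 1 - γh ≠ 0 := (sub_pos.2 hγ1).ne'
    -- components: the pair {0, h; γh} with weight p/(1−γh), the point h with the rest
    refine ⟨Bool, inferInstance, fun i => if i then p / (1 - γh) else (1 - p) - p * γh / (1 - γh), fun i => if i then γh else 1,
      fun i => if i then 0 else h, fun _ => h, ?_, ?_, ?_, ?_, fun _ => hhM, ?_, ?_⟩
    · intro i
      cases i
      · simp only [Bool.false_eq_true, ↓reduceIte]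
        have : p * γh / (1 - γh) ≤ 1 - p := by rw [div_le_iff₀ (by linarith)]; linarith
        linarith
      · simp only [↓reduceIte]; exact div_nonneg hp0 (by linarith)
    · rw [Fintype.sum_bool]; simp only [↓reduceIte, Bool.false_eq_true]
      field_simp; ring
    · intro i; cases i
      · simp only [Bool.false_eq_true, ↓reduceIte]; exact ⟨zero_le_one, le_rfl⟩
      · simp only [↓reduceIte]; exact ⟨hγ0.le, hγ1.le⟩
    · intro i; cases i <;> simp
    · intro t
      rw [Fintype.sum_bool]; simp only [↓reduceIte, Bool.false_eq_true]
      by_cases ht0 : t = 0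
      · subst ht0
        have hne : (0 : ℕ) ≠ h := by omega
        simp only [if_true, if_neg hne]
        field_simp; ring
      · by_cases hth : t = h
        · subst hth
          simp only [if_true, if_neg ht0]
          field_simp; ring
        · simp only [if_neg ht0, if_neg hth]; ring
    · intro i hi
      cases i
      · exact Or.inl ⟨rfl, Or.inl h2h⟩
      · simp only [↓reduceIte]
        exact validAt_creditPair x c (c / h) γh j'' 0 h hh0 hhj hx1 (by simp) hγh

/-- **capacity of one absorber, bounded below** (the key identity).  For an absorber of mass `m ≥ 0` at height `H > 0`, target `c > 0`,
floor `0 < x < 1`, and a number `γ₀ > 0` with `γ₀ ≤ x² + (1−x)c/H` whenever the pair is light (`c < Hx`):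
`CAP ≥ m(H/c − 1) − [c < Hx]·m·x(Hx − c)/(cγ₀)`. [this work] -/
theorem cap_ge (x c γ₀ H m : ℝ) (hx0 : 0 < x) (hx1 : x < 1) (hc : 0 < c) (hH : 0 < H) (hm : 0 ≤ m) (hγ₀ : 0 < γ₀)
    (hγH : c < H * x → γ₀ ≤ x ^ 2 + (1 - x) * (c / H)) :
    m * (H / c - 1) - (if c < H * x then m * (x * (H * x - c)) / (c * γ₀) else 0) ≤ CAP[x, c, H, m] := by
  by_cases hl : c < H * x
  · -- light pair: γ_H = x² + (1−x)c/H ≥ γ₀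
    have hcH : c < H := by nlinarith
    have hρx : c / H < x := by rw [div_lt_iff₀ hH]; linarith
    have hmax : max (c / H) (x ^ 2 + (1 - x) * (c / H)) = x ^ 2 + (1 - x) * (c / H) := by
      refine max_eq_right ?_; nlinarith
    rw [if_pos hl, if_pos hcH, hmax]
    have hγHpos : 0 < x ^ 2 + (1 - x) * (c / H) := by have := div_pos hc hH; nlinarith
    have hγle : γ₀ ≤ x ^ 2 + (1 - x) * (c / H) := hγH hl
    obtain ⟨D, hD⟩ : ∃ D : ℝ, D = x ^ 2 + (1 - x) * (c / H) := ⟨_, rfl⟩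
    rw [← hD] at hγHpos hγle ⊢
    have hDH : D * H = H * x ^ 2 + (1 - x) * c := by rw [hD]; field_simp
    -- identity: m(1−D)/D = m(H/c − 1) − m·x(Hx − c)/(cD)
    have hpoly : m * (1 - D) * c = m * (H - c) * D - m * (x * (H * x - c)) := by linear_combination (-m) * hDH
    have hid : m * (1 - D) / D = m * (H / c - 1) - m * (x * (H * x - c)) / (c * D) := by
      have h1 : m * (1 - D) / D = (m * (H - c) * D - m * (x * (H * x - c))) / (c * D) := by
        rw [div_eq_div_iff hγHpos.ne' (mul_ne_zero hc.ne' hγHpos.ne'),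
          show m * (1 - D) * (c * D) = (m * (1 - D) * c) * D by ring, hpoly]
      rw [h1, sub_div, mul_div_mul_right _ _ hγHpos.ne']
      congr 1
      field_simp
    rw [hid]
    have hnum : 0 ≤ m * (x * (H * x - c)) := mul_nonneg hm (mul_nonneg hx0.le (by linarith))
    have : m * (x * (H * x - c)) / (c * D) ≤ m * (x * (H * x - c)) / (c * γ₀) :=
      div_le_div_of_nonneg_left hnum (mul_pos hc hγ₀) (mul_le_mul_of_nonneg_left hγle hc.le)
    linarith
  · rw [if_neg hl, sub_zero]
    by_cases hcH : c < H
    · -- heavy compatible: γ_H = c/H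
      have hmax : max (c / H) (x ^ 2 + (1 - x) * (c / H)) = c / H := by
        refine max_eq_left ?_
        have : x ≤ c / H := by rw [le_div_iff₀ hH]; linarith
        nlinarith
      rw [if_pos hcH, hmax]
      have : m * (1 - c / H) / (c / H) = m * (H / c - 1) := by field_simp
      rw [this]
    · rw [if_neg hcH]
      have : H / c ≤ 1 := by rw [div_le_one hc]; linarith
      nlinarith

/-- **THE CAPACITY INEQUALITY of sub-case O** (FOR-PROVERS-SL §4, exact): with `κ = (γ − x²)/(1−x)`, `c = Bκ + Ag`, sizes `A, B ≥ 1` (real),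
`0 < x < 1`, `x² < γ < x ≤ g ≤ 1`:  `(1−γ)(1−g) ≤ CAP(B; γ(1−g)) + CAP(A; (1−γ)g) + CAP(B+A; γg)`. [this work] -/
theorem lightTwoBlob_capacity (x γ g κ c A B : ℝ) (hx0 : 0 < x) (hx1 : x < 1) (hγ0 : x ^ 2 < γ) (hγx : γ < x) (hxg : x ≤ g)
    (hg1 : g ≤ 1) (hA : 1 ≤ A) (hB : 1 ≤ B) (hκ : κ = (γ - x ^ 2) / (1 - x)) (hc : c = B * κ + A * g) :
    (1 - γ) * (1 - g) ≤ CAP[x, c, B, γ * (1 - g)] + CAP[x, c, A, (1 - γ) * g] + CAP[x, c, B + A, γ * g] := by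
  have h1x : 0 < 1 - x := by linarith
  have hκ' : (1 - x) * κ = γ - x ^ 2 := by rw [hκ]; field_simp
  have hκ0 : 0 < κ := by rw [hκ]; exact div_pos (by linarith) h1x
  have hκγ : κ < γ := by nlinarith
  have hγpos : 0 < γ := by nlinarith
  have hg0 : 0 < g := lt_of_lt_of_le hx0 hxg
  have hκg : κ ≤ g := by linarith
  have hc0 : 0 < c := by rw [hc]; nlinarith
  have hmbn : 0 ≤ γ * (1 - g) := mul_nonneg hγpos.le (by linarith)
  have hman : 0 ≤ (1 - γ) * g := mul_nonneg (by linarith) hg0.le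
  have hmabn : 0 ≤ γ * g := (mul_pos hγpos hg0).le
  have hBA : 0 < B + A := by linarith
  -- γ ≤ x² + (1−x)·ρ  ⟺  κ ≤ ρ
  have hγρ : ∀ ρ : ℝ, κ ≤ ρ → γ ≤ x ^ 2 + (1 - x) * ρ := fun ρ hρ => by nlinarith
  have eb := cap_ge x c γ B (γ * (1 - g)) hx0 hx1 hc0 (by linarith) hmbn hγpos (fun _ => hγρ _ (by
      rw [le_div_iff₀ (by linarith), hc]; nlinarith))
  have ea := cap_ge x c γ A ((1 - γ) * g) hx0 hx1 hc0 (by linarith) hman hγpos (fun hl => by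
      exfalso
      have : A * x ≤ c := by rw [hc]; nlinarith [mul_le_mul_of_nonneg_left hxg (by linarith : (0:ℝ) ≤ A)]
      linarith)
  have eab := cap_ge x c γ (B + A) (γ * g) hx0 hx1 hc0 hBA hmabn hγpos (fun _ => hγρ _ (by
      rw [le_div_iff₀ hBA, hc]; nlinarith [mul_le_mul_of_nonneg_left hκg (by linarith : (0:ℝ) ≤ A)]))
  -- the correction of the pair into A vanishes (A·x ≤ c); the other two are ≤ (m/γ)·x·B(x−κ)/c
  have La : (if c < A * x then (1 - γ) * g * (x * (A * x - c)) / (c * γ) else 0) = 0 := by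
    rw [if_neg]
    have : A * x ≤ c := by rw [hc]; nlinarith [mul_le_mul_of_nonneg_left hxg (by linarith : (0:ℝ) ≤ A)]
    linarith
  have hBxc : B * x - c ≤ B * (x - κ) := by rw [hc]; nlinarith
  have hBAxc : (B + A) * x - c ≤ B * (x - κ) := by rw [hc]; nlinarith [mul_le_mul_of_nonneg_left hxg (by linarith : (0:ℝ) ≤ A)]
  have hxκ0 : 0 ≤ x - κ := by linarith
  have Lb : (if c < B * x then γ * (1 - g) * (x * (B * x - c)) / (c * γ) else 0) ≤ γ * (1 - g) * (x * (B * (x - κ))) / (c * γ) := by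
    split_ifs with hl
    · exact div_le_div_of_nonneg_right (mul_le_mul_of_nonneg_left (mul_le_mul_of_nonneg_left hBxc hx0.le) hmbn)
        (mul_pos hc0 hγpos).le
    · exact div_nonneg (mul_nonneg hmbn (mul_nonneg hx0.le (mul_nonneg (by linarith) hxκ0))) (mul_pos hc0 hγpos).le
  have Lab : (if c < (B + A) * x then γ * g * (x * ((B + A) * x - c)) / (c * γ) else 0) ≤ γ * g * (x * (B * (x - κ))) / (c * γ) := by
    split_ifs with hl
    · exact div_le_div_of_nonneg_right (mul_le_mul_of_nonneg_left (mul_le_mul_of_nonneg_left hBAxc hx0.le) hmabn)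
        (mul_pos hc0 hγpos).le
    · exact div_nonneg (mul_nonneg hmabn (mul_nonneg hx0.le (mul_nonneg (by linarith) hxκ0))) (mul_pos hc0 hγpos).le
  -- bookkeeping identities
  have hcorr : γ * (1 - g) * (x * (B * (x - κ))) / (c * γ) + γ * g * (x * (B * (x - κ))) / (c * γ) = x * B * (x - κ) / c := by
    field_simp
    ring
  have hγκ : γ - κ = x * (x - κ) := by nlinarith
  have hval : γ * (1 - g) * (B / c - 1) + (1 - γ) * g * (A / c - 1) + γ * g * ((B + A) / c - 1)
      = (1 - γ) * (1 - g) + x * B * (x - κ) / c := by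
    have e1 : γ * (1 - g) * B + (1 - γ) * g * A + γ * g * (B + A) = c + B * (γ - κ) := by rw [hc]; ring
    rw [hγκ] at e1
    field_simp
    linear_combination e1
  linarith [eb, ea, eab, La, Lb, Lab, hcorr, hval]

/-- **the share of atom `0` sent to one absorber** (capacity-proportional split): with `T = CAP(H; m)/S`, `w = m₀T + m`, the two-atom law
`(m₀T/w)·δ₀ + (1 − m₀T/w)·δ_H` is DEC(j″) at target `c` whenever `m₀ ≤ S` (`0 < S`, `c ≤ 2H`, `H ≤ j″`, `H ≤ M`). [this work] -/
theorem decAtT_zeroShare (x c m₀ m S : ℝ) (j'' M H : ℕ) (hx0 : 0 < x) (hx1 : x < 1) (hc0 : 0 < c) (hm₀ : 0 ≤ m₀) (hm : 0 ≤ m)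
    (hS : 0 < S) (hm₀S : m₀ ≤ S) (hHM : H ≤ M) (hHj : H ≤ j'') (h2H : c ≤ 2 * (H : ℝ)) (hH : (0 : ℝ) < H)
    (hw : 0 < m₀ * (CAP[x, c, (H : ℝ), m] / S) + m) :
    DECAtT x c j'' M (fun s => (m₀ * (CAP[x, c, (H : ℝ), m] / S) / (m₀ * (CAP[x, c, (H : ℝ), m] / S) + m)) * (if s = 0 then (1 : ℝ) else 0)
      + (1 - m₀ * (CAP[x, c, (H : ℝ), m] / S) / (m₀ * (CAP[x, c, (H : ℝ), m] / S) + m)) * (if s = H then (1 : ℝ) else 0)) := by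
  obtain ⟨T, hT⟩ : ∃ T : ℝ, T = CAP[x, c, (H : ℝ), m] / S := ⟨_, rfl⟩
  rw [← hT] at hw ⊢
  have hT0 : 0 ≤ T := by
    rw [hT]
    refine div_nonneg ?_ hS.le
    split_ifs with hcH
    · have hρ1 : c / (H : ℝ) < 1 := by rw [div_lt_one hH]; exact hcH
      have hγ0 : 0 < max (c / H) (x ^ 2 + (1 - x) * (c / H)) := lt_of_lt_of_le (div_pos hc0 hH) (le_max_left _ _)
      have hγ1 : max (c / H) (x ^ 2 + (1 - x) * (c / H)) < 1 := by
        refine max_lt hρ1 ?_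
        have h1x : 0 < 1 - x := by linarith
        nlinarith [mul_lt_mul_of_pos_left hρ1 h1x]
      exact div_nonneg (mul_nonneg hm (by linarith)) hγ0.le
    · exact le_rfl
  have hp0 : 0 ≤ m₀ * T / (m₀ * T + m) := div_nonneg (mul_nonneg hm₀ hT0) hw.le
  have hp1 : m₀ * T / (m₀ * T + m) ≤ 1 := by rw [div_le_one hw]; linarith
  refine decAtT_zeroAbsorber x c _ j'' M H hx0 hx1 hp0 hp1 hHM hHj h2H hc0 ?_
  by_cases hcH : c < (H : ℝ)
  · right
    refine ⟨hcH, ?_⟩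
    obtain ⟨γH, hγH⟩ : ∃ γH : ℝ, γH = max (c / H) (x ^ 2 + (1 - x) * (c / H)) := ⟨_, rfl⟩
    have hρ1 : c / (H : ℝ) < 1 := by rw [div_lt_one hH]; exact hcH
    have hγH0 : 0 < γH := by rw [hγH]; exact lt_of_lt_of_le (div_pos hc0 hH) (le_max_left _ _)
    have hγH1 : γH < 1 := by
      rw [hγH]; refine max_lt hρ1 ?_
      have h1x : 0 < 1 - x := by linarith
      nlinarith [mul_lt_mul_of_pos_left hρ1 h1x]
    rw [← hγH]
    have hTeq : T = m * (1 - γH) / γH / S := by rw [hT, if_pos hcH, ← hγH]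
    -- p γH ≤ (1−p)(1−γH)  ⟸  m₀ T γH ≤ m (1 − γH)  ⟸  m₀ ≤ S
    have hkey : m₀ * T * γH ≤ m * (1 - γH) := by
      rw [hTeq]
      have e : m₀ * (m * (1 - γH) / γH / S) * γH = (m₀ / S) * (m * (1 - γH)) := by
        field_simp
      rw [e]
      have hfrac : m₀ / S ≤ 1 := by rw [div_le_one hS]; exact hm₀S
      nlinarith [mul_nonneg hm (by linarith : (0 : ℝ) ≤ 1 - γH)]
    have e1 : m₀ * T / (m₀ * T + m) * γH = (m₀ * T * γH) / (m₀ * T + m) := by ring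
    have e2 : (1 - m₀ * T / (m₀ * T + m)) * (1 - γH) = (m * (1 - γH)) / (m₀ * T + m) := by
      field_simp
      ring
    rw [e1, e2]
    exact div_le_div_of_nonneg_right hkey hw.le
  · left
    have : T = 0 := by rw [hT, if_neg hcH, zero_div]
    rw [this, mul_zero, zero_div]


end LawDec

end Quant

end Summit.CriticalPhenomena.PercolationContinuityZ3.Theorems
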